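import Literature.Analysis.FluidPDE.LoopCirculation
import HarnessLib

/-!
# The near-taut compression rate of a field with bounded gradient is at most the gradient bound

Stub `stub_nearTautCompression_le_of_fderiv_le` of the birth skeleton of the crux
`TautLoopKelvin.TautCompressionIntegrable` (item `stmt-NavierStokesRegularity-15248`): the STATIC
loop-space lemma used in the bounded regime of the composition `TautCompressionIntegrable_of`.

For a vector field `v` on `ℝ³` whose derivative is bounded in operator norm, `‖Dv(x)‖ ≤ L` for all
`x` (`0 ≤ L`), and any level `g`, the near-taut compression rate
`⨅_{ε>0} sSup { −⨍_γ ⟨τ, Dv τ⟩ : γ admissible, length(γ) ≤ ℓ(g) + ε }` is `≤ L`.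

Proof. Every member of the near-taut set is `k = N / ℓ` with `ℓ = ∫₀¹ ‖γ'‖ ≥ 0` and
`N = ∫₀¹ f`, `f σ = −⟪γ' σ, Dv(γ σ) γ' σ⟫ / ‖γ' σ‖`. Pointwise `f σ ≤ L ‖γ' σ‖`
(Cauchy–Schwarz and `‖Dv(γ σ) γ' σ‖ ≤ ‖Dv(γ σ)‖ ‖γ' σ‖ ≤ L ‖γ' σ‖`; the junk value `x / 0 = 0`
covers `γ' σ = 0`), hence `N ≤ L ℓ` whenever `f` and `‖γ'‖` are interval integrable (otherwise
the relevant Bochner integral is `0`), so `k ≤ L` (with `k = N / 0 = 0 ≤ L` when `ℓ = 0`).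
`Real.sSup_le` (which covers `sSup ∅ = 0` and unbounded sets) gives `sSup ≤ L` for every `ε`,
and the `⨅` over `{ε // 0 < ε}` is `≤` its value at `ε = 1` when the range is bounded below and
is the junk value `0 ≤ L` otherwise (`Real.iInf_of_not_bddBelow`). The admissibility conjuncts
(`IsC1Loop`, the circulation floor, the length constraint) and the `C¹` hypothesis on `v` are not
used: the bound holds for every curve `γ : ℝ → ℝ³`.

Mathlib only (`Real.sSup_le`, `Real.iInf_of_not_bddBelow`, `ciInf_le`, `abs_real_inner_le_norm`,
`ContinuousLinearMap.le_opNorm`, `intervalIntegral.integral_mono_on`,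
`intervalIntegral.integral_undef`, `div_le_of_le_mul₀`, `div_le_iff₀`). [folklore]
-/

noncomputable section

open MeasureTheory Set intervalIntegral

namespace Summit.NavierStokesRegularity.NavierStokesRegularity.Theorems.TautCompressionIntegrable.Birth

-- the problem directory repeats the summit name; core's `dupNamespace` linter fires on every decl
set_option linter.dupNamespace false

/-- Pointwise bound on the compression integrand: if `‖Dv(x)‖ ≤ L` everywhere and `0 ≤ L`, then
`−⟪γ' σ, Dv(γ σ) γ' σ⟫ / ‖γ' σ‖ ≤ L ‖γ' σ‖` for every curve `γ` and parameter `σ`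
(Cauchy–Schwarz and the operator-norm bound; `x / 0 = 0` when `γ' σ = 0`). [folklore] -/
private theorem nearTaut_integrand_le {v : EuclideanSpace ℝ (Fin 3) → EuclideanSpace ℝ (Fin 3)}
    {L : ℝ} (hL : 0 ≤ L) (hDv : ∀ x, ‖fderiv ℝ v x‖ ≤ L)
    (γ : ℝ → EuclideanSpace ℝ (Fin 3)) (σ : ℝ) :
    -(inner ℝ (deriv γ σ) (fderiv ℝ v (γ σ) (deriv γ σ))) / ‖deriv γ σ‖ ≤ L * ‖deriv γ σ‖ := by
  refine div_le_of_le_mul₀ (norm_nonneg _) (mul_nonneg hL (norm_nonneg _)) ?_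
  calc -(inner ℝ (deriv γ σ) (fderiv ℝ v (γ σ) (deriv γ σ)))
      ≤ |inner ℝ (deriv γ σ) (fderiv ℝ v (γ σ) (deriv γ σ))| := neg_le_abs _
    _ ≤ ‖deriv γ σ‖ * ‖fderiv ℝ v (γ σ) (deriv γ σ)‖ := abs_real_inner_le_norm _ _
    _ ≤ ‖deriv γ σ‖ * (L * ‖deriv γ σ‖) := by
        gcongr
        exact (ContinuousLinearMap.le_opNorm _ _).trans
          (mul_le_mul_of_nonneg_right (hDv _) (norm_nonneg _))
    _ = L * ‖deriv γ σ‖ * ‖deriv γ σ‖ := by ring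

/-- Every member of the near-taut compression set is at most the gradient bound: for every curve
`γ : ℝ → ℝ³`, `(∫₀¹ −⟪γ', Dv(γ) γ'⟫ / ‖γ'‖) / (∫₀¹ ‖γ'‖) ≤ L` when `‖Dv‖ ≤ L` everywhere and
`0 ≤ L` (length `0`, or a non-integrable integrand, gives the junk value `0 ≤ L`). [folklore] -/
private theorem nearTaut_member_le {v : EuclideanSpace ℝ (Fin 3) → EuclideanSpace ℝ (Fin 3)}
    {L : ℝ} (hL : 0 ≤ L) (hDv : ∀ x, ‖fderiv ℝ v x‖ ≤ L)
    (γ : ℝ → EuclideanSpace ℝ (Fin 3)) :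
    (∫ σ in (0:ℝ)..1, -(inner ℝ (deriv γ σ) (fderiv ℝ v (γ σ) (deriv γ σ))) / ‖deriv γ σ‖) /
        (∫ σ in (0:ℝ)..1, ‖deriv γ σ‖) ≤ L := by
  have hℓ : 0 ≤ ∫ σ in (0:ℝ)..1, ‖deriv γ σ‖ :=
    intervalIntegral.integral_nonneg zero_le_one fun σ _ => norm_nonneg _
  rcases hℓ.eq_or_lt with h0 | hpos
  · rw [← h0, div_zero]
    exact hL
  · rw [div_le_iff₀ hpos]
    have hg : IntervalIntegrable (fun σ => ‖deriv γ σ‖) volume 0 1 := by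
      by_contra h
      exact hpos.ne' (intervalIntegral.integral_undef h)
    by_cases hf : IntervalIntegrable
        (fun σ => -(inner ℝ (deriv γ σ) (fderiv ℝ v (γ σ) (deriv γ σ))) / ‖deriv γ σ‖) volume 0 1
    · calc (∫ σ in (0:ℝ)..1, -(inner ℝ (deriv γ σ) (fderiv ℝ v (γ σ) (deriv γ σ))) / ‖deriv γ σ‖)
          ≤ ∫ σ in (0:ℝ)..1, L * ‖deriv γ σ‖ :=
            intervalIntegral.integral_mono_on zero_le_one hf (hg.const_mul L)
              fun σ _ => nearTaut_integrand_le hL hDv γ σ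
        _ = L * ∫ σ in (0:ℝ)..1, ‖deriv γ σ‖ := intervalIntegral.integral_const_mul L _
    · rw [intervalIntegral.integral_undef hf]
      exact mul_nonneg hL hℓ

/-- Junk-robust infimum bound over the reals: if `0 ≤ L` and every value of `F` is `≤ L`, then
`⨅ i, F i ≤ L` as soon as the index type is inhabited (bounded-below range: `ciInf_le`; otherwise
the infimum is the junk value `0 ≤ L`). [folklore] -/
private theorem nearTaut_iInf_le {ι : Sort*} {F : ι → ℝ} {L : ℝ} (i₀ : ι) (hL : 0 ≤ L)
    (hF : ∀ i, F i ≤ L) : (⨅ i, F i) ≤ L := by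
  by_cases h : BddBelow (Set.range F)
  · exact (ciInf_le h i₀).trans (hF i₀)
  · rw [Real.iInf_of_not_bddBelow h]
    exact hL

/-- **Stub `stub_nearTautCompression_le_of_fderiv_le` (static loop-space bound).** For a `C¹`
vector field `v` on `ℝ³` whose derivative is bounded in operator norm by `L ≥ 0`, and any level
`g`, the near-taut compression rate of `v` at level `g` (verbatim the functional of the crux
`TautCompressionIntegrable`, with `u s` replaced by `v`) is at most `L`. Handles the `ℝ`-valued
junk conventions (`sSup ∅ = 0`, `sSup`/`⨅` of unbounded sets `= 0`, `x / 0 = 0`). [folklore] -/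
theorem stub_nearTautCompression_le_of_fderiv_le :
    ∀ (v : EuclideanSpace ℝ (Fin 3) → EuclideanSpace ℝ (Fin 3)) (L : ℝ), ContDiff ℝ 1 v → 0 ≤ L →
      (∀ x, ‖fderiv ℝ v x‖ ≤ L) → ∀ g : ℝ,
      (⨅ ε : {ε : ℝ // 0 < ε}, sSup {k : ℝ | ∃ γ : ℝ → EuclideanSpace ℝ (Fin 3),
        Literature.Analysis.FluidPDE.IsC1Loop γ ∧ g ≤ |Literature.Analysis.FluidPDE.circulation v γ| ∧
        ENNReal.ofReal (∫ σ in (0:ℝ)..1, ‖deriv γ σ‖) ≤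
          (⨅ (γ' : ℝ → EuclideanSpace ℝ (Fin 3)) (_ : Literature.Analysis.FluidPDE.IsC1Loop γ' ∧
            g ≤ |Literature.Analysis.FluidPDE.circulation v γ'|), ENNReal.ofReal (∫ σ in (0:ℝ)..1, ‖deriv γ' σ‖)) +
          ENNReal.ofReal (ε : ℝ) ∧
        k = ((∫ σ in (0:ℝ)..1, -(inner ℝ (deriv γ σ) (fderiv ℝ v (γ σ) (deriv γ σ))) / ‖deriv γ σ‖) /
          (∫ σ in (0:ℝ)..1, ‖deriv γ σ‖))}) ≤ L := by
  intro v L _ hL hDv g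
  refine nearTaut_iInf_le ⟨1, one_pos⟩ hL fun ε => ?_
  refine Real.sSup_le ?_ hL
  rintro k ⟨γ, -, -, -, rfl⟩
  exact nearTaut_member_le hL hDv γ

end Summit.NavierStokesRegularity.NavierStokesRegularity.Theorems.TautCompressionIntegrable.Birth

end
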